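import Summits.QuantumFields.YangMills.Theorems.AlphaInputsT3ACv3LocalSmallHull
import HarnessLib

/-!
# `AlphaInputsT3ACv3LocalSmallRead` — STRATEGY B for 2′: MEMBERSHIP IN THE LOCALISED SMALL-LOOP CLASS OVER A DEPENDENCY HULL FROM FINE-PLAQUETTE SMALLNESS ON ONE
# BOX PER **READ** BOND, AT THE READ BOND'S OWN SCALE — lane `pub-balaban3d`, seat alpha-2 (g2)

WHAT.  The composition of `AlphaInputsT3ACv3LocalSmallBoxes` (membership from boxes around the CONE bonds; [B7] Props. 1–2 local) with `AlphaInputsT3ACv3LocalSmallHull`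
(every cone bond sits within `hullRad ≤ 3L^{i₀−s}` of the chain below some READ bond of level `i₀`): ★ `nestedSmallOn_hull_of_plaqSmallOn_readBoxes` — `U ∈ NestedSmallOn
expMeanLogSU δ′ (hull R) k` as soon as, for every read bond `c₀ ∈ R i₀` and the chain `xs` of block centres below `c₀.src`, the FINE plaquettes of `U` are
`α₀·(L^{i₀})⁻²`-small on the ONE fine box `boxRegion (xs 0) ((d + 10)·L^{i₀})` — `α₀` in [B7] Prop. 2's window, `(((d+2)L)²/4)(α₀ + 2C₀(d)α₀²) ≤ δ′`, `L ≥ 3`.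
§1 box bookkeeping (`near_mono`, `near_zero_of_chains` — descent of a proximity along two chains, `boxRegion_subset_of_near`); §2 the radius arithmetic; §3 the theorem.
WHY.  This is the interface a (D6L)-core witness meets (HOME `D6-AUDIT-alpha2-g2.md` §4): for the T³ cones `coneT3 k h = hull (readBondsT3 k h)` the read bonds of level `i₀`
lie in `Λ_{i₀}(h)` (or `Ω_k(h)`), so the remaining obligation is Ω-geometry + the profile's fine-plaquette bounds near `Λ_{i₀}(h)` at scale `L^{−2i₀}`.
HONEST FRAMING.  Plumbing of tree theorems; no new estimate; count-neutral helper toward R3 2′ (`stub_laneRecordsV3`, items 19935∕19936); nothing about d = 4, the continuum,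
or a mass gap.

References: T. Bałaban, Commun. Math. Phys. 98 (1985) 17–51 [Balaban1985Averaging] (Props. 1–2 (51)–(54) p.26, (15) p.19); CMP 109 (1987) 249–301 [Balaban1987RG1] ((0.1)–(0.4)).
-/

set_option autoImplicit false

noncomputable section

namespace Summit.QuantumFields.YangMills.Theorems.LocalSmallLoop

open Set
open Literature.MathematicalPhysics.QuantumFieldTheory.Balaban1983to89
open Literature.MathematicalPhysics.QuantumFieldTheory.Balaban1983to89.ExpMeanLog (expMeanLogSU deltaSU)
open Summit.QuantumFields.YangMills.BalabanUVNodes.N20LCSAvgDominationRegion (boxRegion mem_boxRegion)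
open Summit.QuantumFields.YangMills.Theorems.N21LocalAveragedRegularity (exists_embChain mem_ball_emb_of_mem_ball boxRegion_mono)

variable {P : Params}

/-! ## §1 Proximity bookkeeping on the tori -/

/-- Proximity is monotone in the radius. [folklore] -/
theorem near_mono {j : ℕ} {x y : Site P j} {m m' : ℕ} (hmm' : m ≤ m')
    (h : ∀ ν, ∃ e : ℤ, |e| ≤ (m : ℤ) ∧ y ν = x ν + (e : ZMod (P.sitesPerDir j))) :
    ∀ ν, ∃ e : ℤ, |e| ≤ (m' : ℤ) ∧ y ν = x ν + (e : ZMod (P.sitesPerDir j)) := fun ν => by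
  obtain ⟨e, he, hy⟩ := h ν
  exact ⟨e, he.trans (by exact_mod_cast hmm'), hy⟩

/-- A site is within `0` of itself. [folklore] -/
theorem near_self {j : ℕ} (x : Site P j) : ∀ ν, ∃ e : ℤ, |e| ≤ ((0 : ℕ) : ℤ) ∧ x ν = x ν + (e : ZMod (P.sitesPerDir j)) :=
  fun _ => ⟨0, by simp, by simp⟩

/-- **DESCENT OF A PROXIMITY ALONG TWO CHAINS OF BLOCK CENTRES**: if `ys s` is within `m` of `xs s` and both are chains (`· l = emb (· (l+1))`, `l < s`), then `ys 0` is
within `L^s·m` of `xs 0` (`N21….mem_ball_emb_of_mem_ball`, `s` times). [cite: Balaban1987RG1, (0.1) p.251] -/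
theorem near_zero_of_chains : ∀ (s : ℕ) (xs ys : (l : ℕ) → Site P l), (∀ l, l < s → xs l = emb (xs (l + 1))) → (∀ l, l < s → ys l = emb (ys (l + 1))) →
    ∀ (m : ℕ), (∀ ν, ∃ e : ℤ, |e| ≤ (m : ℤ) ∧ (ys s) ν = (xs s) ν + (e : ZMod (P.sitesPerDir s))) →
      ∀ ν, ∃ e : ℤ, |e| ≤ ((P.L ^ s * m : ℕ) : ℤ) ∧ (ys 0) ν = (xs 0) ν + (e : ZMod (P.sitesPerDir 0))
  | 0, xs, ys, _, _, m, h => by simpa using h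
  | s + 1, xs, ys, hxs, hys, m, h => by
    have h1 := mem_ball_emb_of_mem_ball (P := P) h (near_self (emb (ys (s + 1))))
    rw [← hxs s (Nat.lt_succ_self s), ← hys s (Nat.lt_succ_self s), add_zero] at h1
    have h2 := near_zero_of_chains s xs ys (fun l hl => hxs l (Nat.lt_succ_of_lt hl)) (fun l hl => hys l (Nat.lt_succ_of_lt hl)) (P.L * m) h1
    refine near_mono (le_of_eq ?_) h2
    rw [pow_succ]; ring

/-- A box around a site within `m` of `x` lies in the box around `x` of radius `m + ρ`. [folklore] -/
theorem boxRegion_subset_of_near {j : ℕ} {x y : Site P j} {m ρ : ℕ}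
    (h : ∀ ν, ∃ e : ℤ, |e| ≤ (m : ℤ) ∧ y ν = x ν + (e : ZMod (P.sitesPerDir j))) : boxRegion y ρ ⊆ boxRegion x (m + ρ) := by
  intro q hq
  refine mem_boxRegion.mpr fun ν => ?_
  obtain ⟨e₁, he₁, hy⟩ := h ν
  obtain ⟨e₂, he₂, hq⟩ := (mem_boxRegion.mp hq) ν
  refine ⟨e₁ + e₂, (abs_add_le _ _).trans (by push_cast; linarith), ?_⟩
  rw [hq, hy]; push_cast; ring

/-! ## §2 The radius arithmetic -/

/-- The box of the (D6L) plumbing around a cone bond of level `i + 1` descending from a read bond of level `i₀ = i + 1 + n` fits in the box of radius `(d+10)·L^{i₀}` around the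
read bond's chain: `L^{i+1}·hullRad n + L^i·(2L + (d+4)L + 2) ≤ (d+10)·L^{i+1+n}` (`L ≥ 3`). [folklore] -/
theorem radius_le (hL : 3 ≤ P.L) (i n : ℕ) :
    P.L ^ (i + 1) * hullRad P n + P.L ^ i * (2 * P.L + ((P.d + 4) * P.L + 2)) ≤ (P.d + 10) * P.L ^ (i + 1 + n) := by
  have hB : 0 < P.L ^ n := pow_pos P.L_pos n
  have hH : hullRad P n ≤ 3 * P.L ^ n := by have := hullRad_le hL n; omega
  have e : P.L ^ (i + 1 + n) = P.L ^ i * P.L * P.L ^ n := by ring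
  rw [e]
  have t1 : P.L ^ (i + 1) * hullRad P n ≤ P.L ^ i * P.L * (3 * P.L ^ n) := by
    rw [pow_succ]; exact Nat.mul_le_mul_left _ hH
  have t2 : P.L ^ i * (2 * P.L + ((P.d + 4) * P.L + 2)) ≤ P.L ^ i * ((P.d + 7) * P.L) := Nat.mul_le_mul_left _ (by nlinarith)
  have t3 : P.L ^ i * ((P.d + 7) * P.L) ≤ P.L ^ i * ((P.d + 7) * P.L) * P.L ^ n := Nat.le_mul_of_pos_right _ hB
  calc P.L ^ (i + 1) * hullRad P n + P.L ^ i * (2 * P.L + ((P.d + 4) * P.L + 2))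
      ≤ P.L ^ i * P.L * (3 * P.L ^ n) + P.L ^ i * ((P.d + 7) * P.L) * P.L ^ n := add_le_add t1 (t2.trans t3)
    _ = (P.d + 10) * (P.L ^ i * P.L * P.L ^ n) := by ring

/-! ## §3 Membership from one box per read bond -/

/-- **★ MEMBERSHIP IN THE LOCALISED CLASS OVER A DEPENDENCY HULL FROM FINE-PLAQUETTE SMALLNESS ON ONE BOX PER READ BOND.**  Let `R` be a family of read bonds (empty
above the standing range) and `E = hull R`.  If for every read bond `c₀ ∈ R i₀` and the chain of block centres `xs` below `c₀.src` the fine plaquettes of `U` are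
`α₀·(L^{i₀})⁻²`-small on `boxRegion (xs 0) ((d+10)·L^{i₀})`, with `0 < α₀`, `C₀(d)α₀ ≤ ⅓`, `2α₀ ≤ c′₂(d,L,N)`, `(((d+2)L)²/4)(α₀ + 2C₀(d)α₀²) ≤ δ′` and `L ≥ 3`, then
`U ∈ NestedSmallOn expMeanLogSU δ′ (hull R) k` (`k ≤ m + K`). [cite: Balaban1985Averaging, Prop. 2 (52)–(54) p.26 + Prop. 1 (51) p.26 + (15) p.19] -/
theorem nestedSmallOn_hull_of_plaqSmallOn_readBoxes {n : Type*} [Fintype n] [DecidableEq n] [Nonempty n]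
    {R : (i : ℕ) → Set (PBond P i)} (hR : ∀ i, P.m + P.K < i → R i = ∅) {k : ℕ} (hk : k ≤ P.m + P.K) (hL : 3 ≤ P.L) {α₀ δ' : ℝ} (hα : 0 < α₀)
    (hα3 : (143 * ((((P.d + 4 : ℕ) : ℝ)) ^ 2 / 4) ^ 2) * α₀ ≤ 1 / 3)
    (hα2 : 2 * α₀ ≤ 2 * deltaSU n / (((P.d + 4) * P.L : ℕ) : ℝ) ^ 2)
    (hδ' : ((((P.d + 2) * P.L : ℕ) : ℝ) ^ 2 / 4) * (α₀ + 2 * (143 * ((((P.d + 4 : ℕ) : ℝ)) ^ 2 / 4) ^ 2) * α₀ ^ 2) ≤ δ')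
    {U : GaugeField P 0 (Matrix.specialUnitaryGroup n ℂ)}
    (h : ∀ i₀, i₀ ≤ P.m + P.K → ∀ c₀ ∈ R i₀, ∀ xs : (l : ℕ) → Site P l, xs i₀ = c₀.src → (∀ l, l < i₀ → xs l = emb (xs (l + 1))) →
      PlaqSmallOn (↑(boxRegion (xs 0) ((P.d + 10) * P.L ^ i₀)) : Set (Plaq P 0)) (α₀ * (((P.L : ℝ) ^ i₀)⁻¹) ^ 2) U) :
    U ∈ NestedSmallOn (expMeanLogSU (n := n)) δ' (hull R) k := by
  refine nestedSmallOn_of_plaqSmallOn_boxes hk hα hα3 hα2 hδ' fun i hi c hc ys hyi hych => ?_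
  obtain ⟨i₀, hi₀, hi₀m, c₀, hc₀, xs, hxi, hxch, hnear⟩ := near_read_of_mem_hull hR hc
  -- `emb c.src = ys i` is within `L·hullRad (i₀ − (i+1))` of `emb (xs (i+1)) = xs i`
  have h1 := mem_ball_emb_of_mem_ball (P := P) hnear (near_self (emb c.src))
  rw [← hyi, ← hxch i (Nat.lt_of_succ_le hi₀), add_zero] at h1
  -- descend to level 0 along the two chains
  have h2 := near_zero_of_chains i xs ys (fun l hl => hxch l (hl.trans (Nat.lt_of_succ_le hi₀))) hych _ h1
  -- the plumbing box around `ys 0` lies in the read box around `xs 0`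
  obtain ⟨nn, hnn⟩ : ∃ nn, i₀ = i + 1 + nn := ⟨i₀ - (i + 1), by omega⟩
  have hsub : boxRegion (ys 0) (P.L ^ i * (2 * P.L + ((P.d + 4) * P.L + 2))) ⊆ boxRegion (xs 0) ((P.d + 10) * P.L ^ i₀) := by
    refine (boxRegion_subset_of_near h2).trans (boxRegion_mono _ ?_)
    have hr := radius_le (P := P) hL i nn
    have hn' : i₀ - (i + 1) = nn := by omega
    rw [hn', hnn]
    calc P.L ^ i * (P.L * hullRad P nn) + P.L ^ i * (2 * P.L + ((P.d + 4) * P.L + 2))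
        = P.L ^ (i + 1) * hullRad P nn + P.L ^ i * (2 * P.L + ((P.d + 4) * P.L + 2)) := by ring
      _ ≤ (P.d + 10) * P.L ^ (i + 1 + nn) := hr
  intro p hp
  have hlt := h i₀ hi₀m c₀ hc₀ xs hxi hxch p (Finset.mem_coe.mpr (hsub (Finset.mem_coe.mp hp)))
  refine hlt.trans_le (mul_le_mul_of_nonneg_left ?_ hα.le)
  have hLr : (1 : ℝ) ≤ P.L := by exact_mod_cast P.L_pos
  have hpow : (P.L : ℝ) ^ i ≤ (P.L : ℝ) ^ i₀ := pow_le_pow_right₀ hLr (by omega)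
  have hpos : (0 : ℝ) < (P.L : ℝ) ^ i := by positivity
  gcongr

end Summit.QuantumFields.YangMills.Theorems.LocalSmallLoop

end
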